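import Summits.ValiantsHypothesis.ValiantsHypothesis.Theorems.BarrierLeverAnchoredDoorHitsLowerPairsEvalDoor

/-!
# Support item `AnchoredDoorHitsLowerPairs` (stmt-ValiantsHypothesis-22510), line `anchored-peeling`:
# THE ROOTED EVALUATION DOOR — single-root door elements `x_{a(d)} e^{v_d·x}` on a set `D` of column vertices with distinct roots, the
# evaluation elements `e^{ℓ_d} − 1` on the others: the layout is the ROOTED EVALUATION (Hermite) matrix
# `R(U, S) = [A(S) ⊆ U] · ∏_{b ∈ U ∖ A(S)} (Σ_{d ∈ S} θ_{bd})`, `A(S) = a(S ∩ D)`, up to a unitriangular factor; `det R ≠ 0 ⟹ symbolicDet 1 ≠ 0`.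

Helper file (`--supports stmt-ValiantsHypothesis-22510`; cell valiant-natproofs, rung V4, 𝒟-side door (c); registered line
`Cruxes/AnchoredDoorHitsLowerPairs/Lines/anchored_peeling.lean`; prover seat val-np-p1 gen 28; memo HOME/val-np-p1/g28/MEMO-evaldoor-valnp1-g28.md §8).
Closes NO item.

WHAT. The evaluation door of `…EvalDoor` (p712689) reads the row monomial `x^U` at the subset-sum node `p_S`; by the ROOTING LEMMA of the memo (§8: send the
`a`-th coordinate of `v_d` to infinity) its determinant is controlled by the HERMITE variant in which the faces through a rooted vertex `d ∈ D` carry the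
derivative `∂_{a(d)}` instead of the value. That variant is itself a member of 𝔄₁ — vertex `d ∈ D` gets the single-root element `x_{a(d)} ∏_{b ≠ a(d)} (1 + θ_{bd} x_b)`,
the other vertices the ordered-tail element `e^{ℓ_d} − 1` (`rootTheta`, `rootPhi`) — and this file proves its layout is the rooted evaluation matrix up to a
unitriangular factor:
* `RootedDoor.rexp A q` — the rooted exponential coefficient function `U ↦ [A ⊆ U] ∏_{b ∈ U∖A} q_b` (`= [x^U] x^A e^{ℓ_q}`; `EvalDoor.expFun` is `A = ∅`), and the zeon
  product rule `conv (rexp A q) (rexp B q') = rexp (A ∪ B) (q + q')` for disjoint roots (`conv_rexp_rexp`, `Finset.prod_add`);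
* the door coefficient functions (`doorFun_root`, `doorFun_free`), the column functions and the ZETA IDENTITY over the free part of a face
  (`sum_colFun_powerset`), the factorisation `R = (door layout) · ζ'` with `ζ'(j', j) = [w j' ⊆ w j ∧ w j ∩ D ⊆ w j']` (`rootedMatrix_eq_doorMatrix_mul_zeta`);
* **THEOREM `symbolicDet_one_ne_zero_of_rootedDet`:** for any rows `u`, injective lower columns `w`, rooted set `D`, injective root map `a` and weights `θ`:
  `det R ≠ 0 ⟹ symbolicDet 1 h r u w ≠ 0` (every profile: `…_of_rootedDet_mono`). `D = ∅` is the evaluation door.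
* CONJECTURE NODE `Stmt.conjRootedCube` (offered): cube rows (all subsets of an `n`-set), ANY lower column family of `2^n` faces, ANY `n` column vertices `D` with
  distinct roots: some `θ` has `det R ≠ 0`. Numerics (memo §8): 0 failures in ≈ 2 700 (C, D) (and failure exactly when two rooted vertices share a root);
  by the rooting lemma `conjRootedCube` for one `D` implies `Stmt.conjEvalCube` for the same pair (paper), and here directly U1 on the pair
  (`symbolicDet_ne_zero_cube_of_conjRootedCube`).

WHAT THIS IS NOT: the conjecture is NOT proved; no pair is certified; nothing on crux stmt-ValiantsHypothesis-14610 or on `VP` versus `VNP`.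
-/

set_option linter.dupNamespace false

namespace Summit.ValiantsHypothesis.ValiantsHypothesis.Theorems.BarrierLever.AnchoredPeeling

open Finset MvPolynomial
open Summit.ValiantsHypothesis.ValiantsHypothesis.Theorems.BarrierLever.BrickCalculus (pexpo pexpo_def)
open SplitGeneral (conv dlt doorFun coeff_pexpo_mul_conv coeff_pexpo_doorElem coeff_pexpo_one' conv_dlt_left)

noncomputable section

namespace RootedDoor

variable {h : ℕ}

/-! ## 1. Rooted exponential coefficient functions and their zeon product rule -/

/-- **The rooted exponential coefficient function:** `rexp A q U = [A ⊆ U] ∏_{b ∈ U ∖ A} q_b = [x^U] (x^A e^{ℓ_q})` — the functional `∂^A` at the node `q` on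
multilinear polynomials. -/
def rexp (A : Finset (Fin h)) (q : Fin h → ℂ) : Finset (Fin h) → ℂ := fun U => if A ⊆ U then ∏ b ∈ U \ A, q b else 0

/-- `EvalDoor.expFun θ S = rexp ∅ (p_S)`. -/
theorem expFun_eq_rexp (θ : Fin h → Fin h → ℂ) (S U : Finset (Fin h)) :
    EvalDoor.expFun θ S U = rexp ∅ (fun b => ∑ γ ∈ S, θ b γ) U := by
  unfold EvalDoor.expFun rexp
  rw [if_pos (Finset.empty_subset U), Finset.sdiff_empty]

/-- **Zeon product rule for rooted exponentials with disjoint roots:** `(x^A e^{ℓ_q}) (x^B e^{ℓ_{q'}}) = x^{A ∪ B} e^{ℓ_{q + q'}}`. -/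
theorem conv_rexp_rexp {A B : Finset (Fin h)} (hAB : Disjoint A B) (q q' : Fin h → ℂ) (U : Finset (Fin h)) :
    conv (rexp A q) (rexp B q') U = rexp (A ∪ B) (fun b => q b + q' b) U := by
  classical
  unfold SplitGeneral.conv rexp
  by_cases hU : A ∪ B ⊆ U
  · rw [if_pos hU]
    have hA : A ⊆ U := (Finset.subset_union_left).trans hU
    have hB : B ⊆ U := (Finset.subset_union_right).trans hU
    -- reindex the sum by V = A ∪ V', V' ⊆ U \ (A ∪ B)
    set U' := U \ (A ∪ B) with hU'
    have himg : ∀ V ∈ U.powerset, (A ⊆ V ∧ B ⊆ U \ V) ↔ V ∈ (U'.powerset).image (fun V' => A ∪ V') := by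
      intro V hV
      have hVU := Finset.mem_powerset.mp hV
      rw [Finset.mem_image]
      constructor
      · rintro ⟨hAV, hBV⟩
        refine ⟨V \ A, Finset.mem_powerset.mpr ?_, Finset.union_sdiff_of_subset hAV⟩
        intro x hx
        rw [Finset.mem_sdiff] at hx
        rw [hU', Finset.mem_sdiff, Finset.mem_union, not_or]
        refine ⟨hVU hx.1, hx.2, fun hxB => ?_⟩
        have := hBV hxB
        rw [Finset.mem_sdiff] at this
        exact this.2 hx.1
      · rintro ⟨V', hV', rfl⟩
        have hV'U := Finset.mem_powerset.mp hV'
        refine ⟨Finset.subset_union_left, fun x hxB => ?_⟩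
        rw [Finset.mem_sdiff, Finset.mem_union, not_or]
        refine ⟨hB hxB, fun hxA => Finset.disjoint_left.mp hAB hxA hxB, fun hxV' => ?_⟩
        have := hV'U hxV'
        rw [hU', Finset.mem_sdiff, Finset.mem_union, not_or] at this
        exact this.2.2 hxB
    -- split the sum
    have hsum : ∑ V ∈ U.powerset, (if A ⊆ V then ∏ b ∈ V \ A, q b else 0) * (if B ⊆ U \ V then ∏ b ∈ (U \ V) \ B, q' b else 0) =
        ∑ V ∈ (U'.powerset).image (fun V' => A ∪ V'), (∏ b ∈ V \ A, q b) * ∏ b ∈ (U \ V) \ B, q' b := by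
      rw [← Finset.sum_filter_add_sum_filter_not U.powerset (fun V => A ⊆ V ∧ B ⊆ U \ V)]
      have hz : ∑ V ∈ U.powerset.filter (fun V => ¬ (A ⊆ V ∧ B ⊆ U \ V)),
          (if A ⊆ V then ∏ b ∈ V \ A, q b else 0) * (if B ⊆ U \ V then ∏ b ∈ (U \ V) \ B, q' b else 0) = 0 := by
        refine Finset.sum_eq_zero (fun V hV => ?_)
        rw [Finset.mem_filter] at hV
        by_cases h1 : A ⊆ V
        · rw [if_neg (fun h2 => hV.2 ⟨h1, h2⟩), mul_zero]
        · rw [if_neg h1, zero_mul]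
      rw [hz, add_zero]
      have hset : U.powerset.filter (fun V => A ⊆ V ∧ B ⊆ U \ V) = (U'.powerset).image (fun V' => A ∪ V') := by
        ext V
        rw [Finset.mem_filter]
        constructor
        · rintro ⟨hV, hc⟩; exact (himg V hV).mp hc
        · intro hV
          have hVU : V ∈ U.powerset := by
            obtain ⟨V', hV', rfl⟩ := Finset.mem_image.mp hV
            refine Finset.mem_powerset.mpr (Finset.union_subset hA ((Finset.mem_powerset.mp hV').trans Finset.sdiff_subset))
          exact ⟨hVU, (himg V hVU).mpr hV⟩
      rw [hset]
      refine Finset.sum_congr rfl (fun V hV => ?_)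
      obtain ⟨V', hV', rfl⟩ := Finset.mem_image.mp hV
      have hVU : A ∪ V' ∈ U.powerset :=
        Finset.mem_powerset.mpr (Finset.union_subset hA ((Finset.mem_powerset.mp hV').trans Finset.sdiff_subset))
      obtain ⟨h1, h2⟩ := (himg _ hVU).mpr hV
      rw [if_pos h1, if_pos h2]
    rw [hsum, Finset.sum_image]
    · -- now a sum over V' ⊆ U' of ∏_{V'} q * ∏_{U' \ V'} q' = ∏_{U'} (q + q')
      show _ = ∏ b ∈ U', (q b + q' b)
      rw [Finset.prod_add]
      refine Finset.sum_congr rfl (fun V' hV' => ?_)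
      have hV'U := Finset.mem_powerset.mp hV'
      have hdA : Disjoint A V' := by
        rw [Finset.disjoint_left]; intro x hxA hxV'
        have := hV'U hxV'; rw [hU', Finset.mem_sdiff, Finset.mem_union, not_or] at this; exact this.2.1 hxA
      have e1 : (A ∪ V') \ A = V' := by
        rw [Finset.union_sdiff_left]; exact Finset.sdiff_eq_self_of_disjoint hdA.symm
      have e2 : (U \ (A ∪ V')) \ B = U' \ V' := by
        ext x
        simp only [Finset.mem_sdiff, Finset.mem_union, hU', not_or]
        tauto
      rw [e1, e2]
    · intro V₁ hV₁ V₂ hV₂ heq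
      have h1 : Disjoint A V₁ := by
        rw [Finset.disjoint_left]; intro x hxA hx
        have := Finset.mem_powerset.mp hV₁ hx; rw [hU', Finset.mem_sdiff, Finset.mem_union, not_or] at this; exact this.2.1 hxA
      have h2 : Disjoint A V₂ := by
        rw [Finset.disjoint_left]; intro x hxA hx
        have := Finset.mem_powerset.mp hV₂ hx; rw [hU', Finset.mem_sdiff, Finset.mem_union, not_or] at this; exact this.2.1 hxA
      have := congrArg (fun W => W \ A) heq
      simp only [Finset.union_sdiff_left] at this
      rwa [Finset.sdiff_eq_self_of_disjoint h1.symm, Finset.sdiff_eq_self_of_disjoint h2.symm] at this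
  · rw [if_neg hU]
    refine Finset.sum_eq_zero (fun V hV => ?_)
    have hVU := Finset.mem_powerset.mp hV
    by_cases h1 : A ⊆ V
    · rw [if_pos h1, if_neg (fun h2 => hU (Finset.union_subset (h1.trans hVU) (h2.trans Finset.sdiff_subset))), mul_zero]
    · rw [if_neg h1, zero_mul]

/-! ## 2. The rooted point of 𝔄₁ and its door coefficient functions -/

section Door

variable (θ : Fin h → Fin h → ℂ) (D : Finset (Fin h)) (a : Fin h → Fin h)

/-- Root weights: a rooted column vertex `d ∈ D` has the single root `a d` (weight 1); a free vertex keeps the weights `θ · d`. -/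
def rootTheta : Fin h → Fin h → ℂ := fun b d => if d ∈ D then (if b = a d then 1 else 0) else θ b d

/-- Tails: a rooted vertex's element `x_{a d} ∏_{b' ≠ a d}(1 + θ_{b'd} x_{b'})` has tails `θ_{b'd}`; a free vertex has the ordered tails of `EvalDoor.ordPhi`. -/
def rootPhi : Fin h → Fin h → Fin h → ℂ := fun b d b' => if d ∈ D then θ b' d else EvalDoor.ordPhi θ b d b'

variable {θ D a}

/-- **Door coefficient function of a rooted vertex:** `[x^U] D_d = rexp {a d} (θ · d) U = [a d ∈ U] ∏_{b ∈ U ∖ {a d}} θ_{bd}`. -/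
theorem doorFun_root {d : Fin h} (hd : d ∈ D) (U : Finset (Fin h)) :
    doorFun (rootTheta θ D a) (rootPhi θ D) d U = rexp {a d} (fun b => θ b d) U := by
  classical
  unfold SplitGeneral.doorFun rootTheta rootPhi rexp
  simp only [if_pos hd]
  by_cases hU : a d ∈ U
  · rw [if_pos (Finset.singleton_subset_iff.mpr hU), Finset.sum_eq_single (a d)]
    · rw [if_pos rfl, one_mul, Finset.sdiff_singleton_eq_erase]
    · intro b _ hb; rw [if_neg hb, zero_mul]
    · intro hnot; exact absurd hU hnot
  · rw [if_neg (fun hs => hU (Finset.singleton_subset_iff.mp hs))]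
    refine Finset.sum_eq_zero (fun b hb => ?_)
    rw [if_neg (fun hba : b = a d => hU (hba ▸ hb)), zero_mul]

/-- Function form of `doorFun_root`. -/
theorem doorFun_root_eq {d : Fin h} (hd : d ∈ D) :
    doorFun (rootTheta θ D a) (rootPhi θ D) d = rexp {a d} (fun b => θ b d) := funext (doorFun_root hd)

/-- **Door coefficient function of a free vertex:** `rexp ∅ (θ · d) − δ_∅` (= `e^{ℓ_d} − 1`, `EvalDoor.doorFun_ordPhi_eq`). -/
theorem doorFun_free {d : Fin h} (hd : d ∉ D) :
    doorFun (rootTheta θ D a) (rootPhi θ D) d = fun U => rexp ∅ (fun b => θ b d) U - SplitGeneral.dlt ∅ U := by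
  classical
  have hth : ∀ b, rootTheta θ D a b d = θ b d := fun b => by unfold rootTheta; rw [if_neg hd]
  have hph : ∀ b b', rootPhi θ D b d b' = EvalDoor.ordPhi θ b d b' := fun b b' => by unfold rootPhi; rw [if_neg hd]
  have e : doorFun (rootTheta θ D a) (rootPhi θ D) d = doorFun θ (EvalDoor.ordPhi θ) d := by
    funext U; unfold SplitGeneral.doorFun; simp_rw [hth, hph]
  rw [e, EvalDoor.doorFun_ordPhi_eq]
  funext U
  rw [EvalDoor.expFun]
  unfold rexp
  rw [if_pos (Finset.empty_subset U), Finset.sdiff_empty]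
  simp_rw [Finset.sum_singleton]

/-- The column coefficient function of the face `S` in the rooted door: `U ↦ [x^U] ∏_{d ∈ S} D_d`. -/
def colFun (θ : Fin h → Fin h → ℂ) (D : Finset (Fin h)) (a : Fin h → Fin h) (S : Finset (Fin h)) : Finset (Fin h) → ℂ :=
  fun U => coeff (pexpo U ∅) (∏ d ∈ S, doorElem (rootTheta θ D a) (rootPhi θ D) d)

/-- The empty column: `[U = ∅]`. -/
theorem colFun_empty (U : Finset (Fin h)) : colFun θ D a ∅ U = if U = ∅ then 1 else 0 := by
  unfold colFun; rw [Finset.prod_empty, coeff_pexpo_one']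

/-- Adding a vertex to the face convolves the column function with that vertex's door coefficient function. -/
theorem colFun_insert {d : Fin h} {S : Finset (Fin h)} (hdS : d ∉ S) (U : Finset (Fin h)) :
    colFun θ D a (insert d S) U = conv (doorFun (rootTheta θ D a) (rootPhi θ D) d) (colFun θ D a S) U := by
  classical
  unfold colFun
  rw [Finset.prod_insert hdS, coeff_pexpo_mul_conv]
  have e1 : (fun V => coeff (pexpo V ∅) (doorElem (rootTheta θ D a) (rootPhi θ D) d)) = doorFun (rootTheta θ D a) (rootPhi θ D) d :=
    funext (coeff_pexpo_doorElem _ _ d)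
  rw [e1]

/-- The root set of a face: `A(S) = a(S ∩ D)`. -/
def rootSet (D : Finset (Fin h)) (a : Fin h → Fin h) (S : Finset (Fin h)) : Finset (Fin h) := (S ∩ D).image a

/-- The rooted evaluation function of the face `S`: `U ↦ [A(S) ⊆ U] ∏_{b ∈ U ∖ A(S)} p_S(b)`, `p_S(b) = Σ_{d ∈ S} θ_{bd}`. -/
def revalFun (θ : Fin h → Fin h → ℂ) (D : Finset (Fin h)) (a : Fin h → Fin h) (S : Finset (Fin h)) : Finset (Fin h) → ℂ :=
  rexp (rootSet D a S) (fun b => ∑ d ∈ S, θ b d)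

/-- **Purely rooted faces:** for `S₀ ⊆ D` (roots injective) the column function IS the rooted evaluation function `rexp (a S₀) (p_{S₀})`. -/
theorem colFun_rooted (ha : Function.Injective a) {S₀ : Finset (Fin h)} (hS₀ : S₀ ⊆ D) :
    ∀ U, colFun θ D a S₀ U = rexp (S₀.image a) (fun b => ∑ d ∈ S₀, θ b d) U := by
  classical
  induction S₀ using Finset.induction_on with
  | empty =>
    intro U
    rw [colFun_empty, Finset.image_empty]
    unfold rexp
    rw [if_pos (Finset.empty_subset U), Finset.sdiff_empty]
    simp_rw [Finset.sum_empty]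
    by_cases hU : U = ∅
    · rw [if_pos hU, hU, Finset.prod_empty]
    · rw [if_neg hU]; obtain ⟨b, hb⟩ := Finset.nonempty_iff_ne_empty.mpr hU; exact (Finset.prod_eq_zero hb rfl).symm
  | @insert d S₀ hd ih =>
    intro U
    have hdD : d ∈ D := hS₀ (Finset.mem_insert_self d S₀)
    have hS₀D : S₀ ⊆ D := fun x hx => hS₀ (Finset.mem_insert_of_mem hx)
    rw [colFun_insert hd, doorFun_root_eq hdD]
    have hfun : colFun θ D a S₀ = rexp (S₀.image a) (fun b => ∑ d ∈ S₀, θ b d) := funext (ih hS₀D)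
    have hdisj : Disjoint ({a d} : Finset (Fin h)) (S₀.image a) := by
      rw [Finset.disjoint_singleton_left, Finset.mem_image]
      rintro ⟨d', hd', heq⟩
      exact hd (ha heq ▸ hd')
    rw [hfun, conv_rexp_rexp hdisj, Finset.image_insert, Finset.insert_eq]
    congr 1
    funext b
    rw [Finset.sum_insert hd]

/-- **THE ZETA IDENTITY over the free part:** for `S₀ ⊆ D` and `W` disjoint from `D`,
`Σ_{T ⊆ W} colFun (S₀ ∪ T) U = rexp (a S₀) (p_{S₀ ∪ W}) U`. -/
theorem sum_colFun_powerset (ha : Function.Injective a) {S₀ : Finset (Fin h)} (hS₀ : S₀ ⊆ D) (W : Finset (Fin h)) (hW : Disjoint W D) :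
    ∀ U, ∑ T ∈ W.powerset, colFun θ D a (S₀ ∪ T) U = rexp (S₀.image a) (fun b => ∑ d ∈ S₀ ∪ W, θ b d) U := by
  classical
  induction W using Finset.induction_on with
  | empty =>
    intro U
    rw [Finset.powerset_empty, Finset.sum_singleton, Finset.union_empty, colFun_rooted ha hS₀]
  | @insert γ W hγ ih =>
    intro U
    have hγD : γ ∉ D := fun h' => Finset.disjoint_left.mp hW (Finset.mem_insert_self γ W) h'
    have hWD : Disjoint W D := Finset.disjoint_of_subset_left (Finset.subset_insert γ W) hW
    have hγS₀ : γ ∉ S₀ := fun h' => hγD (hS₀ h')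
    rw [Finset.sum_powerset_insert hγ, ih hWD U]
    have hins : ∀ T ∈ W.powerset, colFun θ D a (S₀ ∪ insert γ T) U =
        conv (doorFun (rootTheta θ D a) (rootPhi θ D) γ) (colFun θ D a (S₀ ∪ T)) U := by
      intro T hT
      have hγT : γ ∉ S₀ ∪ T := by
        rw [Finset.mem_union, not_or]; exact ⟨hγS₀, fun h' => hγ (Finset.mem_powerset.mp hT h')⟩
      rw [Finset.union_insert, colFun_insert hγT]
    rw [Finset.sum_congr rfl hins, ← EvalDoor.conv_sum_right]
    have hfun : (fun V => ∑ T ∈ W.powerset, colFun θ D a (S₀ ∪ T) V) = rexp (S₀.image a) (fun b => ∑ d ∈ S₀ ∪ W, θ b d) :=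
      funext (ih hWD)
    rw [hfun, doorFun_free hγD, EvalDoor.conv_sub_left, EvalDoor.conv_dlt_empty_left, conv_rexp_rexp (Finset.disjoint_empty_left _)]
    rw [Finset.empty_union]
    have e : (fun b => θ b γ + ∑ d ∈ S₀ ∪ W, θ b d) = fun b => ∑ d ∈ S₀ ∪ insert γ W, θ b d := by
      funext b
      rw [Finset.union_insert, Finset.sum_insert]
      rw [Finset.mem_union, not_or]; exact ⟨hγS₀, hγ⟩
    rw [e]
    ring

end Door

/-! ## 3. THE ROOTED EVALUATION DOOR -/

section Main

variable (θ : Fin h → Fin h → ℂ) (D : Finset (Fin h)) (a : Fin h → Fin h)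

/-- **The rooted evaluation matrix factors: `R = (rooted door layout) · ζ'`** with `ζ'(j', j) = [w j' ⊆ w j ∧ w j ∩ D ⊆ w j']`. -/
theorem rootedMatrix_eq_doorMatrix_mul_zeta (ha : Function.Injective a) {r : ℕ} (u w : Fin r → Finset (Fin h))
    (hw : Function.Injective w) (hlw : IsLowerSet (Set.range w)) :
    (Matrix.of fun i j : Fin r => revalFun θ D a (w j) (u i)) =
      (Matrix.of fun i j : Fin r => coeff (pexpo (u i) ∅) (∏ d ∈ w j, doorElem (rootTheta θ D a) (rootPhi θ D) d)) *
        (Matrix.of fun j' j : Fin r => if w j' ⊆ w j ∧ w j ∩ D ⊆ w j' then (1 : ℂ) else 0) := by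
  classical
  ext i j
  rw [Matrix.mul_apply, Matrix.of_apply]
  simp only [Matrix.of_apply, mul_ite, mul_one, mul_zero]
  rw [← Finset.sum_filter]
  -- reindex `j'` by the free part `T = w j' \ D ⊆ w j \ D`
  set S₀ := w j ∩ D with hS₀
  set W := w j \ D with hW
  have hS₀D : S₀ ⊆ D := Finset.inter_subset_right
  have hWD : Disjoint W D := Finset.sdiff_disjoint
  have hdecomp : S₀ ∪ W = w j := by rw [hS₀, hW, Finset.union_comm, Finset.sdiff_union_inter]
  have himg : (Finset.univ.filter (fun j' : Fin r => w j' ⊆ w j ∧ w j ∩ D ⊆ w j')).image w = (W.powerset).image (fun T => S₀ ∪ T) := by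
    ext S
    simp only [Finset.mem_image, Finset.mem_filter, Finset.mem_univ, true_and, Finset.mem_powerset]
    constructor
    · rintro ⟨j', ⟨hsub, hcap⟩, rfl⟩
      refine ⟨w j' \ D, ?_, ?_⟩
      · intro x hx; rw [Finset.mem_sdiff] at hx; rw [hW, Finset.mem_sdiff]; exact ⟨hsub hx.1, hx.2⟩
      · ext x
        rw [Finset.mem_union, hS₀, Finset.mem_sdiff]
        constructor
        · rintro (hx | hx)
          · exact hcap hx
          · exact hx.1
        · intro hx
          by_cases hxD : x ∈ D
          · exact Or.inl (Finset.mem_inter.mpr ⟨hsub hx, hxD⟩)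
          · exact Or.inr ⟨hx, hxD⟩
    · rintro ⟨T, hT, rfl⟩
      have hsub : S₀ ∪ T ⊆ w j := by
        rw [← hdecomp]; exact Finset.union_subset_union (le_refl _) hT
      obtain ⟨j', hj'⟩ : S₀ ∪ T ∈ Set.range w := hlw (show S₀ ∪ T ≤ w j from hsub) ⟨j, rfl⟩
      refine ⟨j', ⟨by rw [hj']; exact hsub, by rw [hj']; exact Finset.subset_union_left⟩, hj'⟩
  have hsum : ∑ j' ∈ Finset.univ.filter (fun j' : Fin r => w j' ⊆ w j ∧ w j ∩ D ⊆ w j'),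
      coeff (pexpo (u i) ∅) (∏ d ∈ w j', doorElem (rootTheta θ D a) (rootPhi θ D) d) =
      ∑ S ∈ (Finset.univ.filter (fun j' : Fin r => w j' ⊆ w j ∧ w j ∩ D ⊆ w j')).image w, colFun θ D a S (u i) := by
    rw [Finset.sum_image (fun j₁ _ j₂ _ hj => hw hj)]
    rfl
  rw [hsum, himg, Finset.sum_image]
  · rw [sum_colFun_powerset ha hS₀D W hWD (u i), revalFun, rootSet, hdecomp]
  · intro T₁ hT₁ T₂ hT₂ heq
    have h1 : Disjoint S₀ T₁ := Finset.disjoint_of_subset_right (Finset.mem_powerset.mp hT₁) (hWD.symm.mono_left hS₀D)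
    have h2 : Disjoint S₀ T₂ := Finset.disjoint_of_subset_right (Finset.mem_powerset.mp hT₂) (hWD.symm.mono_left hS₀D)
    have := congrArg (fun X => X \ S₀) heq
    simp only [Finset.union_sdiff_left] at this
    rwa [Finset.sdiff_eq_self_of_disjoint h1.symm, Finset.sdiff_eq_self_of_disjoint h2.symm] at this

/-- **THE ROOTED EVALUATION DOOR.** For any row family `u`, any injective column family `w` with lower range, any set `D` of column vertices with an
injective root map `a`, and weights `θ`: if the rooted evaluation matrix `R(i, j) = [a(w j ∩ D) ⊆ u i] · ∏_{b ∈ u i ∖ a(w j ∩ D)} Σ_{d ∈ w j} θ_{bd}`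
(the Hermite functional `∂^{a(w j ∩ D)}` of the row monomial at the subset-sum node) is nonsingular, then `symbolicDet 1 h r u w ≠ 0`. `D = ∅` is the
evaluation door `EvalDoor.symbolicDet_one_ne_zero_of_evalDet`. -/
theorem symbolicDet_one_ne_zero_of_rootedDet (ha : Function.Injective a) {r : ℕ} (u w : Fin r → Finset (Fin h))
    (hw : Function.Injective w) (hlw : IsLowerSet (Set.range w))
    (hdet : (Matrix.of fun i j : Fin r => revalFun θ D a (w j) (u i)).det ≠ 0) : symbolicDet 1 h r u w ≠ 0 := by
  apply symbolicDet_one_ne_zero_of_doorDet u w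
  refine ⟨rootTheta θ D a, rootPhi θ D, fun hC => hdet ?_⟩
  rw [rootedMatrix_eq_doorMatrix_mul_zeta θ D a ha u w hw hlw, Matrix.det_mul, hC, zero_mul]

/-- The rooted evaluation door at every profile `s ≥ 1`. -/
theorem symbolicDet_ne_zero_of_rootedDet (ha : Function.Injective a) {s r : ℕ} (hs : 1 ≤ s) (u w : Fin r → Finset (Fin h))
    (hw : Function.Injective w) (hlw : IsLowerSet (Set.range w))
    (hdet : (Matrix.of fun i j : Fin r => revalFun θ D a (w j) (u i)).det ≠ 0) : symbolicDet s h r u w ≠ 0 :=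
  symbolicDet_ne_zero_mono hs (symbolicDet_one_ne_zero_of_rootedDet θ D a ha u w hw hlw hdet)

end Main

end RootedDoor

/-! ## 4. Conjecture node: the rooted (Hermite) door on cube rows -/

/-- **CONJECTURE R(cube) — HERMITE INTERPOLATION ON SUBSET SUMS WITH `n` ROOTED VERTICES (offered node text).** For cube rows (all subsets of an `n`-set),
ANY injective lower column family `w` with `2^n` faces, ANY set `D` of column vertices and ANY injective root map `a`, some `θ` makes the rooted evaluation
matrix nonsingular. (Numerics, memo §8: 0 failures for every injective rooting tested; the statement FAILS when two vertices share a root, which `a`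
injective excludes. By the rooting lemma, R(cube) for `D = n` vertices with roots onto the row set is the lowest-order coefficient of `Stmt.conjEvalCube`'s
determinant.) WHY IT MIGHT FAIL: a Hermite configuration with repeated derivative orders inside one generic translate class. -/
def Stmt.conjRootedCube : Prop :=
  ∀ (h r : ℕ) (Dx : Finset (Fin h)) (u w : Fin r → Finset (Fin h)) (D : Finset (Fin h)) (a : Fin h → Fin h),
    Function.Injective u → Function.Injective w → Function.Injective a →
    Set.range u = {S | S ⊆ Dx} → IsLowerSet (Set.range w) →
    ∃ θ : Fin h → Fin h → ℂ, (Matrix.of fun i j : Fin r => RootedDoor.revalFun θ D a (w j) (u i)).det ≠ 0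

/-- **R(cube) ⟹ every cube-row lower pair is hit at every profile** (take `D = ∅`, or any rooting). -/
theorem symbolicDet_ne_zero_cube_of_conjRootedCube (hR : Stmt.conjRootedCube) {s h r : ℕ} (hs : 1 ≤ s) (Dx : Finset (Fin h))
    (u w : Fin r → Finset (Fin h)) (hu : Function.Injective u) (hw : Function.Injective w) (hru : Set.range u = {S | S ⊆ Dx})
    (hlw : IsLowerSet (Set.range w)) : symbolicDet s h r u w ≠ 0 := by
  obtain ⟨θ, hdet⟩ := hR h r Dx u w ∅ id hu hw (fun _ _ hab => hab) hru hlw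
  exact RootedDoor.symbolicDet_ne_zero_of_rootedDet θ ∅ id (fun _ _ hab => hab) hs u w hw hlw hdet

end

end Summit.ValiantsHypothesis.ValiantsHypothesis.Theorems.BarrierLever.AnchoredPeeling
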